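import Summits.QuantumFields.BalabanUV.Beta.GAN24.MixedChannelBondSums

/-!
# `BalabanUV.Beta.GAN24.BondNullComposition` — binder row G-an2-4 / (CONV-C), W-slot, road «W3» (SKELETON-W3 §7.2 / §8.3 (F2)), «W3-ZB*»
# part 5a: A BOND-NULL FAMILY COMPOSED THROUGH `K` WITH A FIXED LOCALISED KERNEL STAYS BOND-NULL AND BECOMES CENTRE-TIED —
# the generic Fubini ∕ localisation bricks for the multiplier legs of the EXCHANGE channels of leaf-04's bracket
# (idle leaf seat `b2b-balaban-gan24-formalise-leaf-14`, gen 23, invitation «W3-ZB*» part 5a; name provisional — the row owner may re-home it)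

NOT IN PRINT; OUR BOOKKEEPING.  HONEST FRAMING (cell contract, verbatim): «discharging `BetaPertH` makes Bałaban's UV stability
UNCONDITIONAL — a real constructive-QFT result; it is NOT the continuum limit and NOT the Clay problem.»  HONEST DEPENDENCY (verbatim):
«continuum YM on T⁴ ⇐ BetaPertH ∧ nine spine estimates (0/9 proved); BetaPertH ⇐ (D1) ∧ (D4) ∧ CAP+tail; G-an2-4 gates asym, D1 and
NE2/3/4.»  [folklore] real analysis on `ℤ^{d+1}` (absolutely convergent double sums, `HasSum.prod_fiberwise` in two orders; triangle
inequalities) over `ExpKernelCalculus.comp` ∕ `BiLoc` ∕ `Decays` BY NAME (`biLoc_comp_biLoc`, `BalabanStepJetsSucc.biLoc_comp_right`,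
`SecondOrderResponse.biLoc_recenter_left/right`, lineage `MultiplierVertexBondSum.summable_exp_coarse`, part 4b
`MixedChannelBondSums.hasSum_tsum_prod_of_bondNull`); no object of Bałaban's is even mentioned; no cited fact, no `def`, no `def … : Prop`,
no wall binder; 0 sorry.  Discharges NOTHING of ROW W3-F2a ∕ F2b, «T2Shape» ∕ «T2SupRate» ∕ (hW, hWall); NOT «W-slot closed», NEVER
«G-an2-4 closed»; NOT BetaPertH, NOT continuum, NOT Clay.

WHY (the located use).  In leaf-06's double-leg currency (`ExchangeReadout.hasSum_mmRead_K3OfK_unitKStep`) the two EXCHANGE terms of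
`K3OfK K♮ Lc S♮ M♮ W b b′` leave the bond sums (over `b′`, at fixed `b`) of `D₁ = Σ'_{(y,w)} ((dM_b ∘ K♮) ∘ dM_b′) y w f g` and
`D₂ = Σ'_{(y,w)} ((dM_b′ ∘ K♮) ∘ dM_b) y w f g`, `dM = vertexOfK … S + vertexOfM … M`.  Every piece carrying a multiplier-column vertex
`vertexOfM K♮ Lc M♮ b″` is a composite of a BOND-NULL family (`MultiplierVertexBondSum`: `Σ_{b″} vertexOfM … b″ = 0` pointwise, (S2c)) bi-localised
at its own (moving) bond with a FIXED kernel localised at the other bond, through `K♮`.  This module proves, once, in generic form: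
* §1 `abs_le_left_of_biLoc` ∕ `abs_le_right_of_biLoc` (one-leg envelopes), **`hasSum_comp_bondNull_right`** (`Q` fixed with a column
  envelope in its second leg, `B u′` with an envelope `e^{−δ|w − N•u′|₁}` and pointwise zero bond sum ⟹ `HasSum (u′ ↦ (Q ∘ B u′) y w f g) 0`)
  and its mirror **`hasSum_comp_bondNull_left`** — one absolutely convergent family on `Site × Site` (bond × middle leg), two orders;
* §2 **`biLoc_comp_centreTied_right ∕ _left`**: `Q` at `(c, c)` and `B` at `(v, v)` (rate `δ`) ⟹ `Q ∘ B` (resp. `B ∘ Q`) is bi-localised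
  at `(c, c)` at rate `δ/4` with constant `|F|·CQ·CB·Zl(δ/2)·e^{−(δ/4)|v − c|₁}` (`biLoc_comp_biLoc` + re-centring of the far leg);
* §3 **`hasSum_tsum_prod_fixedK_bondNull`** (`V u′ := (P ∘ K) ∘ B u′`, `P` fixed at `(c, c)`, `K` decaying, `B u′` at `(N•u′, N•u′)`
  bond-null) and **`hasSum_tsum_prod_bondNullK_fixed`** (`V u′ := (B u′ ∘ K) ∘ P`): `HasSum (u′ ↦ Σ'_{(y,w)} V u′ y w f g) 0` — centre-tied
  by §2, pointwise bond-null by §1, then part 4b's `hasSum_tsum_prod_of_bondNull`.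
Part 5b (`GAN24/MultiplierExchangeBondSums`) instantiates §3 on an2's `vertexOfK` ∕ `vertexOfM` ∕ `dM` and an4's step kernel.
-/

noncomputable section

open Finset
open scoped BigOperators

namespace Summit.QuantumFields.BalabanUV.Beta.GAN24.BondNullComposition

open Literature.MathematicalPhysics.QuantumFieldTheory
open Literature.MathematicalPhysics.QuantumFieldTheory.Balaban1983to89
open Literature.MathematicalPhysics.QuantumFieldTheory.Balaban1983to89.Beta
open AffineAveraging (Site)
open B12Sec2to5 (l1 l1_nonneg)
open ExpKernelCalculus (MKer Decays BiLoc comp Zl Zl_nonneg summable_exp_shift summable_exp_shift' l1_sub_symm biLoc_comp_biLoc)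
open OneStepResolventKernel (Fib biLoc_mono)
open BalabanStepJetsSucc (biLoc_comp_right)
open SecondOrderResponse (biLoc_recenter_left biLoc_recenter_right)
open Summit.QuantumFields.BalabanUV.Beta.GAN24.MultiplierVertexBondSum (summable_exp_coarse)
open Summit.QuantumFields.BalabanUV.Beta.GAN24.MixedChannelBondSums (hasSum_tsum_prod_of_bondNull)

variable {d : ℕ}

/-! ## §1 One composition: bond-null in, bond-null out -/

section OneComp

variable {N : ℕ} [NeZero N]

/-- [folklore] One-leg envelope of a bi-localised kernel (first leg). -/
theorem abs_le_left_of_biLoc {X : MKer (d + 1) (Fib d)} {p q : Site (d + 1)} {C δ : ℝ} (h : BiLoc X p q C δ) (hδ : 0 ≤ δ)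
    (x z : Site (d + 1)) (a b : Fib d) : |X x z a b| ≤ C * Real.exp (-δ * l1 (x - p)) := by
  have hC : 0 ≤ C := h.nonneg a
  refine (h x z a b).trans (mul_le_mul_of_nonneg_left (Real.exp_le_exp.2 ?_) hC)
  nlinarith [l1_nonneg (z - q), l1_nonneg (x - p)]

/-- [folklore] One-leg envelope of a bi-localised kernel (second leg). -/
theorem abs_le_right_of_biLoc {X : MKer (d + 1) (Fib d)} {p q : Site (d + 1)} {C δ : ℝ} (h : BiLoc X p q C δ) (hδ : 0 ≤ δ)
    (x z : Site (d + 1)) (a b : Fib d) : |X x z a b| ≤ C * Real.exp (-δ * l1 (z - q)) := by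
  have hC : 0 ≤ C := h.nonneg a
  refine (h x z a b).trans (mul_le_mul_of_nonneg_left (Real.exp_le_exp.2 ?_) hC)
  nlinarith [l1_nonneg (z - q), l1_nonneg (x - p)]

/-- [folklore] **BOND-NULL ON THE RIGHT OF A FIXED KERNEL.**  `Q` fixed with a summable column envelope in its middle leg
(`|Q y w₁ f g₁| ≤ CQ·e^{−δ|w₁ − c|₁}`), `B u′` a bond family with the envelope `|B u′ w₁ w g₁ g| ≤ CB·e^{−δ|w − N•u′|₁}` and POINTWISE zero bond
sum ⟹ `HasSum (u′ ↦ (Q ∘ B u′) y w f g) 0`.  The family `(u′, w₁) ↦ Σ_{g₁} Q y w₁ f g₁ · B u′ w₁ w g₁ g` converges absolutely; summed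
`u′`-first it vanishes, summed `w₁`-first its fibres are the compositions. -/
theorem hasSum_comp_bondNull_right {Q : MKer (d + 1) (Fib d)} {B : Site (d + 1) → MKer (d + 1) (Fib d)}
    {y w c : Site (d + 1)} {f g : Fib d} {CQ CB δ : ℝ} (hδ : 0 < δ)
    (hQ : ∀ w₁ g₁, |Q y w₁ f g₁| ≤ CQ * Real.exp (-δ * l1 (w₁ - c)))
    (hB : ∀ u' w₁ g₁, |B u' w₁ w g₁ g| ≤ CB * Real.exp (-δ * l1 (w - (N : ℤ) • u')))
    (hB0 : ∀ w₁ g₁, HasSum (fun u' : Site (d + 1) => B u' w₁ w g₁ g) 0) :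
    HasSum (fun u' : Site (d + 1) => comp Q (B u') y w f g) 0 := by
  classical
  have hCQ : 0 ≤ CQ := nonneg_of_mul_nonneg_left ((abs_nonneg _).trans (hQ c f)) (Real.exp_pos _)
  have hCB : 0 ≤ CB := nonneg_of_mul_nonneg_left ((abs_nonneg _).trans (hB 0 c f)) (Real.exp_pos _)
  set cF : ℝ := ((Fintype.card (Fib d) : ℕ) : ℝ) with hcF
  set Φ : Site (d + 1) × Site (d + 1) → ℝ := fun p => ∑ g₁, Q y p.2 f g₁ * B p.1 p.2 w g₁ g with hΦ
  have hΦle : ∀ p, |Φ p| ≤ cF * ((CB * Real.exp (-δ * l1 (w - (N : ℤ) • p.1))) * (CQ * Real.exp (-δ * l1 (p.2 - c)))) := by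
    intro p
    calc |Φ p| ≤ ∑ g₁, |Q y p.2 f g₁ * B p.1 p.2 w g₁ g| := Finset.abs_sum_le_sum_abs _ _
      _ ≤ ∑ _g₁ : Fib d, (CB * Real.exp (-δ * l1 (w - (N : ℤ) • p.1))) * (CQ * Real.exp (-δ * l1 (p.2 - c))) := by
          refine Finset.sum_le_sum fun g₁ _ => ?_
          rw [abs_mul, mul_comm]
          exact mul_le_mul (hB p.1 p.2 g₁) (hQ p.2 g₁) (abs_nonneg _) (mul_nonneg hCB (Real.exp_pos _).le)
      _ = _ := by simp only [Finset.sum_const, Finset.card_univ, nsmul_eq_mul, hcF]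
  have hmaj : Summable fun p : Site (d + 1) × Site (d + 1) =>
      cF * ((CB * Real.exp (-δ * l1 (w - (N : ℤ) • p.1))) * (CQ * Real.exp (-δ * l1 (p.2 - c)))) := by
    have h1 : Summable fun u' : Site (d + 1) => CB * Real.exp (-δ * l1 (w - (N : ℤ) • u')) :=
      (summable_exp_coarse (N := N) hδ w).mul_left CB
    have h2 : Summable fun w₁ : Site (d + 1) => CQ * Real.exp (-δ * l1 (w₁ - c)) := (summable_exp_shift' hδ c).mul_left CQ
    exact (h1.mul_of_nonneg h2 (fun _ => mul_nonneg hCB (Real.exp_pos _).le) (fun _ => mul_nonneg hCQ (Real.exp_pos _).le)).mul_left cF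
  have hΦs : Summable Φ := Summable.of_norm_bounded hmaj (fun p => by rw [Real.norm_eq_abs]; exact hΦle p)
  -- `u′`-first: zero fibrewise
  have hfib : ∀ w₁ : Site (d + 1), HasSum (fun u' : Site (d + 1) => Φ (u', w₁)) 0 := by
    intro w₁
    have h := hasSum_sum (s := (Finset.univ : Finset (Fib d))) fun g₁ _ => (hB0 w₁ g₁).mul_left (Q y w₁ f g₁)
    simp only [mul_zero, Finset.sum_const_zero] at h
    exact h
  have htot' : ∑' p : Site (d + 1) × Site (d + 1), Φ (p.2, p.1) = 0 :=
    (hΦs.prod_symm.hasSum.prod_fiberwise hfib).unique hasSum_zero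
  have htot : ∑' p, Φ p = 0 := by
    rw [← htot']
    exact ((Equiv.prodComm (Site (d + 1)) (Site (d + 1))).tsum_eq Φ).symm
  -- `w₁`-first: the fibres are the compositions
  have h3 := hΦs.hasSum.prod_fiberwise fun u' => (hΦs.prod_factor u').hasSum
  rw [htot] at h3
  exact h3

/-- [folklore] **BOND-NULL ON THE LEFT OF A FIXED KERNEL.**  `P` fixed with a summable envelope in its middle leg
(`|P w₂ w g₂ g| ≤ CP·e^{−δ|w₂ − c|₁}`), `B u′` with `|B u′ y w₂ f g₂| ≤ CB·e^{−δ|y − N•u′|₁}` and POINTWISE zero bond sum ⟹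
`HasSum (u′ ↦ (B u′ ∘ P) y w f g) 0`. -/
theorem hasSum_comp_bondNull_left {P : MKer (d + 1) (Fib d)} {B : Site (d + 1) → MKer (d + 1) (Fib d)}
    {y w c : Site (d + 1)} {f g : Fib d} {CP CB δ : ℝ} (hδ : 0 < δ)
    (hP : ∀ w₂ g₂, |P w₂ w g₂ g| ≤ CP * Real.exp (-δ * l1 (w₂ - c)))
    (hB : ∀ u' w₂ g₂, |B u' y w₂ f g₂| ≤ CB * Real.exp (-δ * l1 (y - (N : ℤ) • u')))
    (hB0 : ∀ w₂ g₂, HasSum (fun u' : Site (d + 1) => B u' y w₂ f g₂) 0) :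
    HasSum (fun u' : Site (d + 1) => comp (B u') P y w f g) 0 := by
  classical
  have hCP : 0 ≤ CP := nonneg_of_mul_nonneg_left ((abs_nonneg _).trans (hP c g)) (Real.exp_pos _)
  have hCB : 0 ≤ CB := nonneg_of_mul_nonneg_left ((abs_nonneg _).trans (hB 0 c f)) (Real.exp_pos _)
  set cF : ℝ := ((Fintype.card (Fib d) : ℕ) : ℝ) with hcF
  set Φ : Site (d + 1) × Site (d + 1) → ℝ := fun p => ∑ g₂, B p.1 y p.2 f g₂ * P p.2 w g₂ g with hΦ
  have hΦle : ∀ p, |Φ p| ≤ cF * ((CB * Real.exp (-δ * l1 (y - (N : ℤ) • p.1))) * (CP * Real.exp (-δ * l1 (p.2 - c)))) := by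
    intro p
    calc |Φ p| ≤ ∑ g₂, |B p.1 y p.2 f g₂ * P p.2 w g₂ g| := Finset.abs_sum_le_sum_abs _ _
      _ ≤ ∑ _g₂ : Fib d, (CB * Real.exp (-δ * l1 (y - (N : ℤ) • p.1))) * (CP * Real.exp (-δ * l1 (p.2 - c))) := by
          refine Finset.sum_le_sum fun g₂ _ => ?_
          rw [abs_mul]
          exact mul_le_mul (hB p.1 p.2 g₂) (hP p.2 g₂) (abs_nonneg _) (mul_nonneg hCB (Real.exp_pos _).le)
      _ = _ := by simp only [Finset.sum_const, Finset.card_univ, nsmul_eq_mul, hcF]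
  have hmaj : Summable fun p : Site (d + 1) × Site (d + 1) =>
      cF * ((CB * Real.exp (-δ * l1 (y - (N : ℤ) • p.1))) * (CP * Real.exp (-δ * l1 (p.2 - c)))) := by
    have h1 : Summable fun u' : Site (d + 1) => CB * Real.exp (-δ * l1 (y - (N : ℤ) • u')) :=
      (summable_exp_coarse (N := N) hδ y).mul_left CB
    have h2 : Summable fun w₂ : Site (d + 1) => CP * Real.exp (-δ * l1 (w₂ - c)) := (summable_exp_shift' hδ c).mul_left CP
    exact (h1.mul_of_nonneg h2 (fun _ => mul_nonneg hCB (Real.exp_pos _).le) (fun _ => mul_nonneg hCP (Real.exp_pos _).le)).mul_left cF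
  have hΦs : Summable Φ := Summable.of_norm_bounded hmaj (fun p => by rw [Real.norm_eq_abs]; exact hΦle p)
  have hfib : ∀ w₂ : Site (d + 1), HasSum (fun u' : Site (d + 1) => Φ (u', w₂)) 0 := by
    intro w₂
    have h := hasSum_sum (s := (Finset.univ : Finset (Fib d))) fun g₂ _ => (hB0 w₂ g₂).mul_right (P w₂ w g₂ g)
    simp only [zero_mul, Finset.sum_const_zero] at h
    exact h
  have htot' : ∑' p : Site (d + 1) × Site (d + 1), Φ (p.2, p.1) = 0 :=
    (hΦs.prod_symm.hasSum.prod_fiberwise hfib).unique hasSum_zero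
  have htot : ∑' p, Φ p = 0 := by
    rw [← htot']
    exact ((Equiv.prodComm (Site (d + 1)) (Site (d + 1))).tsum_eq Φ).symm
  have h3 := hΦs.hasSum.prod_fiberwise fun u' => (hΦs.prod_factor u').hasSum
  rw [htot] at h3
  exact h3

end OneComp

/-! ## §2 Composition with a kernel localised elsewhere: centre-tied localisation -/

/-- [folklore] **CENTRE-TIED LOCALISATION, FAR FACTOR ON THE RIGHT**: `Q` bi-localised at `(c, c)` and `B` at `(v, v)` (rate `δ > 0`) ⟹
`Q ∘ B` is bi-localised at `(c, c)` at rate `δ/4` with constant `|F|·CQ·CB·Zl(δ/2)·e^{−(δ/4)|v − c|₁}` (`biLoc_comp_biLoc` gives the far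
decay `e^{−(δ/2)|c − v|₁}` at the mixed centres `(c, v)`; half of it re-centres the right leg to `c`). -/
theorem biLoc_comp_centreTied_right {Q B : MKer (d + 1) (Fib d)} {c v : Site (d + 1)} {CQ CB δ : ℝ} (hδ : 0 < δ)
    (hQ : BiLoc Q c c CQ δ) (hB : BiLoc B v v CB δ) :
    BiLoc (comp Q B) c c
      ((Fintype.card (Fib d) : ℝ) * (CQ * CB) * Zl (d + 1) (δ / 2) * Real.exp (-(δ / 4) * l1 (v - c))) (δ / 4) := by
  have hCQ : 0 ≤ CQ := hQ.nonneg (Sum.inl 0)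
  have hCB : 0 ≤ CB := hB.nonneg (Sum.inl 0)
  have hZ : 0 ≤ Zl (d + 1) (δ / 2) := Zl_nonneg (by positivity)
  have h1 := biLoc_comp_biLoc hQ hB hδ
  have hA : 0 ≤ (Fintype.card (Fib d) : ℝ) * (CQ * CB) * Zl (d + 1) (δ / 2) := by positivity
  have e : (Fintype.card (Fib d) : ℝ) * (CQ * CB) * Zl (d + 1) (δ / 2) * Real.exp (-(δ / 2) * l1 (c - v))
      = ((Fintype.card (Fib d) : ℝ) * (CQ * CB) * Zl (d + 1) (δ / 2) * Real.exp (-(δ / 4) * l1 (v - c)))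
        * Real.exp (-(δ / 4) * l1 (c - v)) := by
    rw [l1_sub_symm v c, mul_assoc (_ * _ * _), ← Real.exp_add]
    congr 1
    ring
  have h2 : BiLoc (comp Q B) c v
      (((Fintype.card (Fib d) : ℝ) * (CQ * CB) * Zl (d + 1) (δ / 2) * Real.exp (-(δ / 4) * l1 (v - c)))
        * Real.exp (-(δ / 4) * l1 (c - v))) (δ / 4) := by
    have h := biLoc_mono h1 (by positivity) (show δ / 4 ≤ δ by linarith)
    rwa [e] at h
  exact biLoc_recenter_right h2 (by positivity) (by positivity) le_rfl

/-- [folklore] **CENTRE-TIED LOCALISATION, FAR FACTOR ON THE LEFT**: `B` at `(v, v)`, `Q` at `(c, c)` ⟹ `B ∘ Q` is bi-localised at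
`(c, c)` at rate `δ/4` with constant `|F|·CB·CQ·Zl(δ/2)·e^{−(δ/4)|v − c|₁}`. -/
theorem biLoc_comp_centreTied_left {Q B : MKer (d + 1) (Fib d)} {c v : Site (d + 1)} {CQ CB δ : ℝ} (hδ : 0 < δ)
    (hB : BiLoc B v v CB δ) (hQ : BiLoc Q c c CQ δ) :
    BiLoc (comp B Q) c c
      ((Fintype.card (Fib d) : ℝ) * (CB * CQ) * Zl (d + 1) (δ / 2) * Real.exp (-(δ / 4) * l1 (v - c))) (δ / 4) := by
  have hCQ : 0 ≤ CQ := hQ.nonneg (Sum.inl 0)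
  have hCB : 0 ≤ CB := hB.nonneg (Sum.inl 0)
  have hZ : 0 ≤ Zl (d + 1) (δ / 2) := Zl_nonneg (by positivity)
  have h1 := biLoc_comp_biLoc hB hQ hδ
  have e : (Fintype.card (Fib d) : ℝ) * (CB * CQ) * Zl (d + 1) (δ / 2) * Real.exp (-(δ / 2) * l1 (v - c))
      = ((Fintype.card (Fib d) : ℝ) * (CB * CQ) * Zl (d + 1) (δ / 2) * Real.exp (-(δ / 4) * l1 (v - c)))
        * Real.exp (-(δ / 4) * l1 (c - v)) := by
    rw [l1_sub_symm c v, mul_assoc (_ * _ * _), ← Real.exp_add]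
    congr 1
    ring
  have h2 : BiLoc (comp B Q) v c
      (((Fintype.card (Fib d) : ℝ) * (CB * CQ) * Zl (d + 1) (δ / 2) * Real.exp (-(δ / 4) * l1 (v - c)))
        * Real.exp (-(δ / 4) * l1 (c - v))) (δ / 4) := by
    have h := biLoc_mono h1 (by positivity) (show δ / 4 ≤ δ by linarith)
    rwa [e] at h
  exact biLoc_recenter_left h2 (by positivity) (by positivity) le_rfl

/-! ## §3 Through `K` and over the two legs: zero bond sum of the double-leg sums -/

section TwoLegs

variable {N : ℕ} [NeZero N] {K P : MKer (d + 1) (Fib d)} {B : Site (d + 1) → MKer (d + 1) (Fib d)} {C CP CB δ : ℝ}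
  {c : Site (d + 1)}

/-- [folklore] **`(P ∘ K) ∘ B u′` — FIXED LOCALISED KERNEL, THEN `K`, THEN A BOND-NULL VERTEX FAMILY: the double-leg sums have zero bond sum.**
`K` decaying, `P` bi-localised at `(c, c)`, every `B u′` bi-localised at `(N•u′, N•u′)` (one constant, one rate) with POINTWISE zero bond sum
⟹ `HasSum (u′ ↦ Σ'_{(y,w)} ((P ∘ K) ∘ B u′) y w f g) 0`. -/
theorem hasSum_tsum_prod_fixedK_bondNull (hK : Decays K C δ) (hδ : 0 < δ) (hP : BiLoc P c c CP δ)
    (hB : ∀ u', BiLoc (B u') ((N : ℤ) • u') ((N : ℤ) • u') CB δ)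
    (hB0 : ∀ w₁ w g₁ g, HasSum (fun u' : Site (d + 1) => B u' w₁ w g₁ g) 0) (f g : Fib d) :
    HasSum (fun u' : Site (d + 1) => ∑' yw : Site (d + 1) × Site (d + 1), comp (comp P K) (B u') yw.1 yw.2 f g) 0 := by
  have hCB : 0 ≤ CB := (hB 0).nonneg (Sum.inl 0)
  have hδ2 : 0 < δ / 2 := half_pos hδ
  -- the fixed factor `P ∘ K`, at rate `δ/2`
  have hQ := biLoc_comp_right hP hK hδ2.le (half_lt_self hδ)
  rw [show δ - δ / 2 = δ / 2 by ring] at hQ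
  have hCQ : 0 ≤ (Fintype.card (Fib d) : ℝ) * (CP * C) * Zl (d + 1) (δ / 2) := hQ.nonneg (Sum.inl 0)
  have hB2 : ∀ u', BiLoc (B u') ((N : ℤ) • u') ((N : ℤ) • u') CB (δ / 2) := fun u' => biLoc_mono (hB u') hCB (by linarith)
  -- centre-tied localisation at rate `δ/8`
  have hVb : ∀ u', BiLoc (comp (comp P K) (B u')) c c
      (((Fintype.card (Fib d) : ℝ) * ((Fintype.card (Fib d) : ℝ) * (CP * C) * Zl (d + 1) (δ / 2) * CB) * Zl (d + 1) (δ / 2 / 2))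
        * Real.exp (-(δ / 2 / 4) * l1 ((N : ℤ) • u' - c))) (δ / 2 / 4) :=
    fun u' => biLoc_comp_centreTied_right hδ2 hQ (hB2 u')
  -- pointwise bond-null
  have hV0 : ∀ (y w : Site (d + 1)) (f' g' : Fib d),
      HasSum (fun u' : Site (d + 1) => comp (comp P K) (B u') y w f' g') 0 := by
    intro y w f' g'
    exact hasSum_comp_bondNull_right (c := c) hδ2 (fun w₁ g₁ => abs_le_right_of_biLoc hQ hδ2.le y w₁ f' g₁)
      (fun u' w₁ g₁ => abs_le_right_of_biLoc (hB2 u') hδ2.le w₁ w g₁ g') (fun w₁ g₁ => hB0 w₁ w g₁ g')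
  exact hasSum_tsum_prod_of_bondNull (by positivity) hVb hV0 f g

/-- [folklore] **`(B u′ ∘ K) ∘ P` — A BOND-NULL VERTEX FAMILY, THEN `K`, THEN A FIXED LOCALISED KERNEL: the double-leg sums have zero bond sum.**
`HasSum (u′ ↦ Σ'_{(y,w)} ((B u′ ∘ K) ∘ P) y w f g) 0` under the hypotheses of `hasSum_tsum_prod_fixedK_bondNull`. -/
theorem hasSum_tsum_prod_bondNullK_fixed (hK : Decays K C δ) (hδ : 0 < δ) (hP : BiLoc P c c CP δ)
    (hB : ∀ u', BiLoc (B u') ((N : ℤ) • u') ((N : ℤ) • u') CB δ)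
    (hB0 : ∀ y w₂ f g₂, HasSum (fun u' : Site (d + 1) => B u' y w₂ f g₂) 0) (f g : Fib d) :
    HasSum (fun u' : Site (d + 1) => ∑' yw : Site (d + 1) × Site (d + 1), comp (comp (B u') K) P yw.1 yw.2 f g) 0 := by
  have hC : 0 ≤ C := hK.nonneg (Sum.inl 0)
  have hCP : 0 ≤ CP := hP.nonneg (Sum.inl 0)
  have hCB : 0 ≤ CB := (hB 0).nonneg (Sum.inl 0)
  have hδ2 : 0 < δ / 2 := half_pos hδ
  -- the moving factor `B u′ ∘ K`, at rate `δ/2`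
  have hBK : ∀ u', BiLoc (comp (B u') K) ((N : ℤ) • u') ((N : ℤ) • u')
      ((Fintype.card (Fib d) : ℝ) * (CB * C) * Zl (d + 1) (δ / 2)) (δ / 2) := by
    intro u'
    have h := biLoc_comp_right (hB u') hK hδ2.le (half_lt_self hδ)
    rwa [show δ - δ / 2 = δ / 2 by ring] at h
  have hCBK : 0 ≤ (Fintype.card (Fib d) : ℝ) * (CB * C) * Zl (d + 1) (δ / 2) := (hBK 0).nonneg (Sum.inl 0)
  have hP2 : BiLoc P c c CP (δ / 2) := biLoc_mono hP hCP (by linarith)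
  -- centre-tied localisation at rate `δ/8`
  have hVb : ∀ u', BiLoc (comp (comp (B u') K) P) c c
      (((Fintype.card (Fib d) : ℝ) * (((Fintype.card (Fib d) : ℝ) * (CB * C) * Zl (d + 1) (δ / 2)) * CP) * Zl (d + 1) (δ / 2 / 2))
        * Real.exp (-(δ / 2 / 4) * l1 ((N : ℤ) • u' - c))) (δ / 2 / 4) :=
    fun u' => biLoc_comp_centreTied_left hδ2 (hBK u') hP2
  -- the inner family `B u′ ∘ K` is pointwise bond-null (bond-null ∘ fixed, with `K`'s translation-invariant envelope)
  have hBK0 : ∀ (y w₂ : Site (d + 1)) (f' g₂ : Fib d), HasSum (fun u' : Site (d + 1) => comp (B u') K y w₂ f' g₂) 0 := by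
    intro y w₂ f' g₂
    refine hasSum_comp_bondNull_left (c := w₂) (CP := C) hδ (fun w₃ g₃ => ?_)
      (fun u' w₃ g₃ => abs_le_left_of_biLoc (hB u') hδ.le y w₃ f' g₃) (fun w₃ g₃ => hB0 y w₃ f' g₃)
    exact hK w₃ w₂ g₃ g₂
  -- pointwise bond-null of the composite
  have hV0 : ∀ (y w : Site (d + 1)) (f' g' : Fib d),
      HasSum (fun u' : Site (d + 1) => comp (comp (B u') K) P y w f' g') 0 := by
    intro y w f' g'
    exact hasSum_comp_bondNull_left (c := c) hδ2 (fun w₂ g₂ => abs_le_left_of_biLoc hP2 hδ2.le w₂ w g₂ g')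
      (fun u' w₂ g₂ => abs_le_left_of_biLoc (hBK u') hδ2.le y w₂ f' g₂) (fun w₂ g₂ => hBK0 y w₂ f' g₂)
  exact hasSum_tsum_prod_of_bondNull (by positivity) hVb hV0 f g

end TwoLegs

end Summit.QuantumFields.BalabanUV.Beta.GAN24.BondNullComposition

end
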